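import Literature.NumberTheory.EllipticCurves.WeilPairingProofs
import Literature.NumberTheory.GaloisRepresentations.ModNCyclotomicCharacter
import HarnessLib

/-!
# `det = χ_m` frame-free (a cyclic stable line with trivial quotient action carries the cyclotomic
# character) and the bookkeeping of `ker f ⊓ A[pⁿ]`

Cell `bsd-eis`, seat `bsd-line-x1-p1-w4` gen 6 (width seat on crux 2 `GoodLatticeBDPValue`,
stmt-BirchSwinnertonDyer-19032, line `halves`). ROUTE-FREE helper (`--supports` the crux): the two
curve-free / place-free tools of brick **F3 «ordinary level 9 at 3»** of the AN-3 Stub B road (w3 g4's memo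
`AN3-StubB-elementary-road.md` §4), consumed by the sequel `EisensteinPrimesFullDescentOrdinaryKernel`
(the kernels `Λ = ker f ⊓ E[p]`, `K₂ = ker f ⊓ E[p²]` of reduction at a good ordinary place). THEOREMS ONLY
(no definition, no named fact, no `sorry`); nothing here closes a stub or proves a summit statement.

* §1 `smul_eq_modNCyclotomicCharacter_smul_of_cyclic` — for `W/F` elliptic over a perfect field, `m ≥ 2`
  invertible in `F`, a CYCLIC subgroup `H ≤ E[m]`, and `σ ∈ Γ_F` with `σ • H ⊆ H` acting trivially on
  `E[m]/H`: `σ • x = χ_m(σ) • x` on `H` (`χ_m` = `modNCyclotomicCharacter F m`). Proof by the Weil pairing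
  (tree theorem `exists_weilPairing_holds`): `e(Y, σX) = e(σY, σX) = e(Y, X)^{χ(σ)}` because `σY − Y ∈ H`
  pairs trivially with the isotropic `H`, then non-degeneracy. This is `det ρ̄_m = χ_m`
  (Cornell–Silverman–Stevens Ch. II §7–§8) for the triangular shape `(a *; 0 1)`, without choosing a frame.
* §2 for `f : A →+ B`, `p` prime: `ker f ⊓ A[p] ≤ ker f ⊓ A[p²]`, `(ker f ⊓ A[p²]) ⊓ A[p] = ker f ⊓ A[p]`,
  `p • (ker f ⊓ A[p²]) ≤ ker f ⊓ A[p]`, the dichotomy `ker f ⊓ A[p²] = ker f ⊓ A[p] ∨ #(ker f ⊓ A[p²]) = p²`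
  when `#(ker f ⊓ A[p]) = p` (`eq_or_natCard_eq_sq`), `#A[n] = #(ker f ⊓ A[n]) · #f(A[n])`
  (`natCard_torsionBy_eq_mul`), and `forall_mem_exists_nsmul_eq` (a point of order `#S` in `S` generates
  `S` by ℕ-multiples).
* §3 (appended) `smul_sub_mem_zmultiples_of_smul_eq_modNCyclotomicCharacter` — the CONVERSE of §1: if `σ`
  acts on a point `x₁ ∈ E[m]` of order `m` by `χ_m(σ)`, then `σ` acts trivially on `E[m]/⟨x₁⟩` (Weil pairing:
  `⟨x₁⟩` is its own orthogonal, `e(x₁, σy)^{χ} = e(x₁, y)^{χ}` with `χ` a unit mod `m`).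

References: [SilvermanCSS1997] Ch. II §7 Proposition, §8; [SilvermanAEC2009] Prop. III.8.1.
-/

set_option linter.dupNamespace false
set_option autoImplicit false

noncomputable section

open scoped Classical AddSubgroup

namespace Summit.BirchSwinnertonDyer.BirchSwinnertonDyer.Theorems.FullDescentOrdinaryNine

open _root_.WeierstrassCurve Literature.NumberTheory.EllipticCurves
  Literature.NumberTheory.GaloisRepresentations Field

universe u

/-! ## §1 A cyclic stable subgroup with trivial quotient action carries the cyclotomic character -/

/-- **`det = χ_m`, frame-free.** Let `W/F` be an elliptic curve over a perfect field, `m ≥ 2`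
invertible in `F`, `H ≤ E[m]` a subgroup whose elements are multiples of one point `x₁ ∈ E[m]`
(cyclic), and `σ ∈ Γ_F` with `σ • H ⊆ H` and `σ • y − y ∈ H` for all `y ∈ E[m]`. Then
`σ • x = χ_m(σ) • x` for every `x ∈ H`, `χ_m` the mod `m` cyclotomic character. Proof with the Weil
pairing `e` (`exists_weilPairing_holds`): `e(σY, σX) = σ • e(Y, X) = e(Y, X)^{χ(σ)} = e(Y, χ(σ)X)` and
`e(σY, σX) = e(Y, σX) · e(σY − Y, σX) = e(Y, σX)` (a cyclic subgroup is isotropic, `e(T, T) = 1`), so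
`σX − χ(σ)X` pairs trivially with everything and vanishes by non-degeneracy. This is `det ρ̄_m = χ_m`
(Cornell–Silverman–Stevens Ch. II §7–§8) applied to the triangular shape `(a *; 0 1)`.
[cite: SilvermanCSS1997, Ch. II §7 Proposition and §8] [cite: SilvermanAEC2009, Prop. III.8.1] -/
theorem smul_eq_modNCyclotomicCharacter_smul_of_cyclic
    {F : Type u} [Field F] [PerfectField F] (W : WeierstrassCurve F) [W.IsElliptic]
    (m : ℕ) [NeZero m] [NeZero (m : F)] (hm : 2 ≤ m)
    {H : AddSubgroup (geomPoints W)} (hH : H ≤ geomTorsion W m)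
    (hcyc : ∃ x₁ ∈ geomTorsion W m, ∀ x ∈ H, ∃ k : ℕ, x = k • x₁)
    (σ : absoluteGaloisGroup F) (hstab : ∀ x ∈ H, σ • x ∈ H)
    (htriv : ∀ y ∈ geomTorsion W m, σ • y - y ∈ H) :
    ∀ x ∈ H, σ • x = ((modNCyclotomicCharacter F m σ : (ZMod m)ˣ) : ZMod m).val • x := by
  have hm0 : m ≠ 0 := NeZero.ne m
  obtain ⟨e, hpow, haddl, haddr, halt, hnd, hgal⟩ :=
    exists_weilPairing_holds W m hm (NeZero.ne (m : F))
  have hne : ∀ S T, e S T ≠ 0 := fun S T h0 ↦ by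
    have := hpow S T
    rw [h0, zero_pow hm0] at this
    exact zero_ne_one this
  have hzero_left : ∀ T, e 0 T = 1 := fun T ↦ by
    have h := haddl 0 0 T
    rw [add_zero] at h
    exact (mul_eq_left₀ (hne 0 T)).mp h.symm
  have hzero_right : ∀ S, e S 0 = 1 := fun S ↦ by
    have h := haddr S 0 0
    rw [add_zero] at h
    exact (mul_eq_left₀ (hne S 0)).mp h.symm
  have hnsmul_left : ∀ (a : ℕ) S T, e (a • S) T = e S T ^ a := fun a S T ↦ by
    induction a with
    | zero => rw [zero_nsmul, pow_zero, hzero_left]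
    | succ a ih => rw [succ_nsmul, haddl, ih, pow_succ]
  have hnsmul_right : ∀ (a : ℕ) S T, e S (a • T) = e S T ^ a := fun a S T ↦ by
    induction a with
    | zero => rw [zero_nsmul, pow_zero, hzero_right]
    | succ a ih => rw [succ_nsmul, haddr, ih, pow_succ]
  -- a cyclic subgroup is isotropic
  obtain ⟨x₁, hx₁, hgen⟩ := hcyc
  have hiso : ∀ S T : geomTorsion W m, (S : geomPoints W) ∈ H → (T : geomPoints W) ∈ H →
      e S T = 1 := by
    intro S T hS hT
    obtain ⟨a, ha⟩ := hgen _ hS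
    obtain ⟨b, hb⟩ := hgen _ hT
    have hS' : S = a • (⟨x₁, hx₁⟩ : geomTorsion W m) := Subtype.ext (by
      rw [AddSubmonoidClass.coe_nsmul]; exact ha)
    have hT' : T = b • (⟨x₁, hx₁⟩ : geomTorsion W m) := Subtype.ext (by
      rw [AddSubmonoidClass.coe_nsmul]; exact hb)
    rw [hS', hT', hnsmul_left, hnsmul_right, halt, one_pow, one_pow]
  -- the Galois action on the values of `e` is through `χ_m`
  set χ : ℕ := ((modNCyclotomicCharacter F m σ : (ZMod m)ˣ) : ZMod m).val with hχ
  have hgalχ : ∀ S T : geomTorsion W m, e (σ • S) (σ • T) = e S T ^ χ := fun S T ↦ by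
    rw [← hgal, modNCyclotomicCharacter_spec F m σ (e S T) (hpow S T)]
  intro x hx
  set X : geomTorsion W m := ⟨x, hH hx⟩ with hXdef
  have hσX : ((σ • X : geomTorsion W m) : geomPoints W) ∈ H := by
    rw [AddSubgroup.torsionBy.coe_smul]; exact hstab x hx
  -- `σ X − χ X` pairs trivially with every `Y`
  have hkey : ∀ Y : geomTorsion W m, e Y (σ • X - χ • X) = 1 := by
    intro Y
    have hK : ((σ • Y - Y : geomTorsion W m) : geomPoints W) ∈ H := by
      rw [AddSubgroupClass.coe_sub, AddSubgroup.torsionBy.coe_smul]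
      exact htriv _ Y.2
    have g2 : e (σ • Y) (σ • X) = e Y (σ • X) := by
      have : σ • Y = Y + (σ • Y - Y) := by abel
      rw [this, haddl, hiso _ _ hK hσX, mul_one]
    have g3 : e Y (σ • X) = e Y (χ • X) := by rw [← g2, hgalχ Y X, hnsmul_right]
    have g5 : e Y (σ • X) = e Y (σ • X - χ • X) * e Y (χ • X) := by
      rw [← haddr, sub_add_cancel]
    rw [g3] at g5
    exact (mul_eq_right₀ (hne Y _)).mp g5.symm
  have h0 : σ • X - χ • X = 0 := hnd _ hkey
  have h1 := congrArg (fun P : geomTorsion W m ↦ (P : geomPoints W)) h0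
  simp only [AddSubgroupClass.coe_sub, AddSubgroup.torsionBy.coe_smul, ZeroMemClass.coe_zero] at h1
  exact sub_eq_zero.mp h1

/-! ## §2 Abstract bookkeeping: `K_n = ker f ⊓ A[pⁿ]` -/

section Group

variable {A B : Type*} [AddCommGroup A] [AddCommGroup B] (f : A →+ B) (p : ℕ)

/-- `ker f ⊓ A[p] ≤ ker f ⊓ A[p²]`. [folklore] -/
theorem ker_inf_torsionBy_le_sq : f.ker ⊓ A[(p : ℕ)] ≤ f.ker ⊓ A[(p ^ 2 : ℕ)] := by
  intro x hx
  obtain ⟨h1, h2⟩ := AddSubgroup.mem_inf.mp hx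
  refine AddSubgroup.mem_inf.mpr ⟨h1, ?_⟩
  rw [mem_torsionBy_iff] at h2 ⊢
  rw [Nat.cast_pow, pow_two, mul_smul, h2, smul_zero]

/-- `(ker f ⊓ A[p²]) ⊓ A[p] = ker f ⊓ A[p]`. [folklore] -/
theorem ker_inf_torsionBy_sq_inf :
    f.ker ⊓ A[(p ^ 2 : ℕ)] ⊓ A[(p : ℕ)] = f.ker ⊓ A[(p : ℕ)] := by
  apply le_antisymm
  · exact fun x hx ↦ AddSubgroup.mem_inf.mpr
      ⟨(AddSubgroup.mem_inf.mp (AddSubgroup.mem_inf.mp hx).1).1, (AddSubgroup.mem_inf.mp hx).2⟩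
  · exact fun x hx ↦ AddSubgroup.mem_inf.mpr
      ⟨ker_inf_torsionBy_le_sq f p hx, (AddSubgroup.mem_inf.mp hx).2⟩

/-- `p • (ker f ⊓ A[p²]) ≤ ker f ⊓ A[p]`. [folklore] -/
theorem nsmul_mem_ker_inf_torsionBy {x : A} (hx : x ∈ f.ker ⊓ A[(p ^ 2 : ℕ)]) :
    p • x ∈ f.ker ⊓ A[(p : ℕ)] := by
  obtain ⟨h1, h2⟩ := AddSubgroup.mem_inf.mp hx
  refine AddSubgroup.mem_inf.mpr ⟨?_, ?_⟩
  · rw [AddMonoidHom.mem_ker] at h1 ⊢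
    rw [map_nsmul, h1, smul_zero]
  · rw [mem_torsionBy_iff] at h2 ⊢
    rw [← natCast_zsmul, smul_smul, ← Nat.cast_mul, ← pow_two, h2]

/-- **Dichotomy for the level-`p²` kernel.** If `#(ker f ⊓ A[p]) = p` (`p` prime) then either
`ker f ⊓ A[p²] = ker f ⊓ A[p]` or `#(ker f ⊓ A[p²]) = p²`: multiplication by `p` maps
`K₂ = ker f ⊓ A[p²]` to `K₁ = ker f ⊓ A[p]` with kernel `K₁`, and its image has order `1` or `p`.
[folklore] -/
theorem eq_or_natCard_eq_sq (hp : p.Prime) (hcard : Nat.card ↥(f.ker ⊓ A[(p : ℕ)]) = p) :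
    f.ker ⊓ A[(p ^ 2 : ℕ)] = f.ker ⊓ A[(p : ℕ)] ∨
      Nat.card ↥(f.ker ⊓ A[(p ^ 2 : ℕ)]) = p ^ 2 := by
  set K₁ := f.ker ⊓ A[(p : ℕ)] with hK₁
  set K₂ := f.ker ⊓ A[(p ^ 2 : ℕ)] with hK₂
  haveI : Finite K₁ := Nat.finite_of_card_ne_zero (by rw [hcard]; exact hp.ne_zero)
  let g : K₂ →+ K₁ :=
    { toFun := fun x ↦ ⟨p • (x : A), nsmul_mem_ker_inf_torsionBy f p x.2⟩
      map_zero' := Subtype.ext (by simp)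
      map_add' := fun x y ↦ Subtype.ext (by simp [smul_add]) }
  have hgker : ∀ x : K₂, x ∈ g.ker ↔ (x : A) ∈ K₁ := by
    intro x
    rw [AddMonoidHom.mem_ker]
    constructor
    · intro h
      have h' : p • (x : A) = 0 := congrArg Subtype.val h
      exact AddSubgroup.mem_inf.mpr ⟨(AddSubgroup.mem_inf.mp x.2).1,
        mem_torsionBy_iff.mpr (by rw [natCast_zsmul]; exact h')⟩
    · intro h
      exact Subtype.ext (by
        change p • (x : A) = 0
        rw [← natCast_zsmul]; exact mem_torsionBy_iff.mp (AddSubgroup.mem_inf.mp h).2)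
  have hkcard : Nat.card g.ker = p := by
    rw [← hcard]
    exact Nat.card_congr
      { toFun := fun x ↦ ⟨(x.1 : A), (hgker x.1).mp x.2⟩
        invFun := fun y ↦ ⟨⟨(y : A), ker_inf_torsionBy_le_sq f p y.2⟩, (hgker _).mpr y.2⟩
        left_inv := fun x ↦ rfl
        right_inv := fun y ↦ rfl }
  have hmul : Nat.card g.ker * Nat.card g.range = Nat.card K₂ := by
    rw [← AddSubgroup.index_ker, AddSubgroup.card_mul_index]
  have hdvd : Nat.card g.range ∣ p := by
    rw [← hcard]; exact AddSubgroup.card_addSubgroup_dvd_card _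
  rcases (Nat.dvd_prime hp).mp hdvd with h1 | h1
  · left
    refine le_antisymm (fun x hx ↦ ?_) (ker_inf_torsionBy_le_sq f p)
    have hbot : g.range = ⊥ := AddSubgroup.eq_bot_of_card_eq (g.range) h1
    have hgx : g ⟨x, hx⟩ = 0 := by
      have : g ⟨x, hx⟩ ∈ g.range := ⟨_, rfl⟩
      rw [hbot] at this
      exact this
    exact (hgker ⟨x, hx⟩).mp hgx
  · right
    rw [← hmul, hkcard, h1, pow_two]

/-- **`#A[n] = #(ker f ⊓ A[n]) · #f(A[n])`** (first isomorphism theorem for `f|A[n]`). [folklore] -/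
theorem natCard_torsionBy_eq_mul (n : ℕ) :
    Nat.card (A[(n : ℕ)]) = Nat.card ↥(f.ker ⊓ A[(n : ℕ)]) * Nat.card ((A[(n : ℕ)]).map f) := by
  let g : A[(n : ℕ)] →+ B := f.comp (A[(n : ℕ)]).subtype
  have hrange : g.range = (A[(n : ℕ)]).map f := by
    rw [AddMonoidHom.range_comp, AddSubgroup.range_subtype]
  have hker : Nat.card g.ker = Nat.card ↥(f.ker ⊓ A[(n : ℕ)]) := by
    exact Nat.card_congr
      { toFun := fun x ↦ ⟨(x.1 : A), AddSubgroup.mem_inf.mpr ⟨x.2, x.1.2⟩⟩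
        invFun := fun y ↦
          ⟨⟨(y : A), (AddSubgroup.mem_inf.mp y.2).2⟩, (AddSubgroup.mem_inf.mp y.2).1⟩
        left_inv := fun x ↦ rfl
        right_inv := fun y ↦ rfl }
  rw [← hker, ← hrange, ← AddSubgroup.index_ker, AddSubgroup.card_mul_index]

omit [AddCommGroup B] in
/-- **A point of order `#S` in a finite subgroup `S` generates it by ℕ-multiples.** [folklore] -/
theorem forall_mem_exists_nsmul_eq {S : AddSubgroup A} {n : ℕ} (hn : 0 < n) (hS : Nat.card S = n)
    {x₁ : A} (hx₁ : x₁ ∈ S) (hord : addOrderOf x₁ = n) :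
    ∀ x ∈ S, ∃ k : ℕ, x = k • x₁ := by
  haveI : Finite S := Nat.finite_of_card_ne_zero (by rw [hS]; exact hn.ne')
  have hle : AddSubgroup.zmultiples x₁ ≤ S := AddSubgroup.zmultiples_le_of_mem hx₁
  have hzc : Nat.card (AddSubgroup.zmultiples x₁) = n := by rw [Nat.card_zmultiples, hord]
  have heq : AddSubgroup.zmultiples x₁ = S :=
    AddSubgroup.eq_of_le_of_card_ge hle (by rw [hS, hzc])
  intro x hx
  rw [← heq, AddSubgroup.mem_zmultiples_iff] at hx
  obtain ⟨k, rfl⟩ := hx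
  refine ⟨(k % n).toNat, ?_⟩
  have hn0 : (n : ℤ) ≠ 0 := by exact_mod_cast hn.ne'
  have hmod : ((k % n).toNat : ℤ) = k % n := Int.toNat_of_nonneg (Int.emod_nonneg _ hn0)
  have hnx : (n : ℤ) • x₁ = 0 := by rw [natCast_zsmul, ← hord, addOrderOf_nsmul_eq_zero]
  calc k • x₁ = (n * (k / n) + k % n) • x₁ := by rw [Int.mul_ediv_add_emod]
    _ = (k % n) • x₁ := by rw [add_zsmul, mul_comm, mul_zsmul, hnx, smul_zero, zero_add]
    _ = (k % n).toNat • x₁ := by rw [← natCast_zsmul, hmod]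

end Group

/-! ## §3 The converse: a cyclic line of order `m` carrying `χ_m` has trivial quotient action -/

/-- **Converse of §1.** Let `W/F` be an elliptic curve over a perfect field, `m ≥ 2` invertible in `F`,
`x₁ ∈ E[m]` a point of order exactly `m`, and `σ ∈ Γ_F` with `σ • x₁ = χ_m(σ) • x₁`. Then `σ` acts
trivially on `E[m]/⟨x₁⟩`: `σ • y − y ∈ ℤ • x₁` for every `y ∈ E[m]`. Proof with the Weil pairing `e`:
`y ↦ e(x₁, y)` is a homomorphism `E[m] → μ_m` whose image has exact order `m` (if `e(x₁, ·)^d = 1` then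
`e(d • x₁, ·) = 1`, so `d • x₁ = 0` by non-degeneracy and alternation, so `m ∣ d`); its kernel therefore has
order `m² / m = m` and contains the isotropic `⟨x₁⟩` of order `m`, hence equals it; finally
`e(x₁, σy)^{χ(σ)} = e(σx₁, σy) = σ • e(x₁, y) = e(x₁, y)^{χ(σ)}` and `χ(σ)` is a unit modulo `m`, so
`e(x₁, σy − y) = 1`. (This is `det ρ̄_m = χ_m` read as: diagonal entry `χ_m` on the line forces `1` on the
quotient; Cornell–Silverman–Stevens Ch. II §7–§8.)
[cite: SilvermanCSS1997, Ch. II §7 Proposition and §8] [cite: SilvermanAEC2009, Prop. III.8.1] -/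
theorem smul_sub_mem_zmultiples_of_smul_eq_modNCyclotomicCharacter
    {F : Type u} [Field F] [PerfectField F] (W : WeierstrassCurve F) [W.IsElliptic]
    (m : ℕ) [NeZero m] [NeZero (m : F)] (hm : 2 ≤ m)
    {x₁ : geomPoints W} (hx₁ : x₁ ∈ geomTorsion W m) (hord : addOrderOf x₁ = m)
    (σ : absoluteGaloisGroup F)
    (hσ : σ • x₁ = ((modNCyclotomicCharacter F m σ : (ZMod m)ˣ) : ZMod m).val • x₁) :
    ∀ y ∈ geomTorsion W m, σ • y - y ∈ AddSubgroup.zmultiples x₁ := by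
  have hm0 : m ≠ 0 := NeZero.ne m
  obtain ⟨e, hpow, haddl, haddr, halt, hnd, hgal⟩ :=
    exists_weilPairing_holds W m hm (NeZero.ne (m : F))
  have hne : ∀ S T, e S T ≠ 0 := fun S T h0 ↦ by
    have := hpow S T
    rw [h0, zero_pow hm0] at this
    exact zero_ne_one this
  have hzero_left : ∀ T, e 0 T = 1 := fun T ↦ by
    have h := haddl 0 0 T
    rw [add_zero] at h
    exact (mul_eq_left₀ (hne 0 T)).mp h.symm
  have hzero_right : ∀ S, e S 0 = 1 := fun S ↦ by
    have h := haddr S 0 0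
    rw [add_zero] at h
    exact (mul_eq_left₀ (hne S 0)).mp h.symm
  have hnsmul_left : ∀ (a : ℕ) S T, e (a • S) T = e S T ^ a := fun a S T ↦ by
    induction a with
    | zero => rw [zero_nsmul, pow_zero, hzero_left]
    | succ a ih => rw [succ_nsmul, haddl, ih, pow_succ]
  have hnsmul_right : ∀ (a : ℕ) S T, e S (a • T) = e S T ^ a := fun a S T ↦ by
    induction a with
    | zero => rw [zero_nsmul, pow_zero, hzero_right]
    | succ a ih => rw [succ_nsmul, haddr, ih, pow_succ]
  -- alternation `e S T * e T S = 1`, hence non-degeneracy in the first slot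
  have hanti : ∀ S T, e S T * e T S = 1 := fun S T ↦ by
    have h := halt (S + T)
    rw [haddl, haddr, haddr, halt S, halt T, one_mul, mul_one] at h
    exact h
  have hnd' : ∀ S, (∀ T, e S T = 1) → S = 0 := fun S hS ↦ hnd S fun T ↦ by
    have h := hanti S T
    rw [hS T, one_mul] at h
    exact h
  -- `m`-th roots of unity: `a ^ n = a ^ (n % m)`
  have hmod : ∀ a : AlgebraicClosure F, a ^ m = 1 → ∀ n : ℕ, a ^ n = a ^ (n % m) := fun a ha n ↦ by
    conv_lhs => rw [← Nat.mod_add_div n m, pow_add, pow_mul, ha, one_pow, mul_one]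
  -- the point `X = x₁` of `E[m]`, of order `m`, and `E[m]` of order `m²`
  set X : geomTorsion W m := ⟨x₁, hx₁⟩ with hXdef
  have hXord : addOrderOf X = m := by
    rw [← addOrderOf_injective (geomTorsion W m).subtype Subtype.val_injective X]
    exact hord
  have hmF : ((m : ℕ) : AlgebraicClosure F) ≠ 0 := by
    rw [← map_natCast (algebraMap F (AlgebraicClosure F))]
    exact (map_ne_zero _).mpr (NeZero.ne (m : F))
  have hE : Nat.card (geomTorsion W m) = m ^ 2 :=
    card_torsionBy_eq_sq (E := W.baseChange (AlgebraicClosure F)) (n := m) hmF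
  haveI : Finite (geomTorsion W m) := Nat.finite_of_card_ne_zero (by rw [hE]; exact pow_ne_zero 2 hm0)
  -- the subgroup `K = {T : e(X, T) = 1}` and its index `d`
  let K : AddSubgroup (geomTorsion W m) :=
    { carrier := {T | e X T = 1}
      add_mem' := fun {a b} ha hb ↦ by
        change e X (a + b) = 1
        rw [haddr, show e X a = 1 from ha, show e X b = 1 from hb, one_mul]
      zero_mem' := hzero_right X
      neg_mem' := fun {a} ha ↦ by
        change e X (-a) = 1
        have h : e X (-a) * e X a = 1 := by rw [← haddr, neg_add_cancel, hzero_right]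
        rwa [show e X a = 1 from ha, mul_one] at h }
  have hKmem : ∀ T, T ∈ K ↔ e X T = 1 := fun T ↦ Iff.rfl
  set d := K.index with hd
  -- `d • X = 0`, so `m ∣ d`
  have hdX : d • X = 0 := by
    refine hnd' _ fun T ↦ ?_
    rw [hnsmul_left, ← hnsmul_right]
    exact (hKmem _).mp (AddSubgroup.nsmul_index_mem K T)
  have hmd : m ∣ d := by rw [← hXord]; exact addOrderOf_dvd_iff_nsmul_eq_zero.mpr hdX
  -- `⟨X⟩ ≤ K` has order `m`, `#K · d = m²`: so `K = ⟨X⟩`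
  have hXle : AddSubgroup.zmultiples X ≤ K := AddSubgroup.zmultiples_le_of_mem ((hKmem X).mpr (halt X))
  have hzc : Nat.card (AddSubgroup.zmultiples X) = m := by rw [Nat.card_zmultiples, hXord]
  have hmul : Nat.card K * d = m ^ 2 := by rw [hd, AddSubgroup.card_mul_index, hE]
  have hmK : m ∣ Nat.card K := by
    have h := AddSubgroup.card_dvd_of_le hXle
    rwa [hzc] at h
  have hKcard : Nat.card K = m := by
    obtain ⟨a, ha⟩ := hmK
    obtain ⟨b, hb⟩ := hmd
    rw [ha, hb, pow_two] at hmul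
    have hmpos : 0 < m := Nat.pos_of_ne_zero hm0
    have hab : a * b = 1 := by
      have h : m * m * (a * b) = m * m * 1 := by
        rw [mul_one]
        calc m * m * (a * b) = m * a * (m * b) := by ring
          _ = m * m := hmul
      exact Nat.eq_of_mul_eq_mul_left (Nat.mul_pos hmpos hmpos) h
    rw [ha, Nat.eq_one_of_mul_eq_one_right hab, mul_one]
  have hK : K = AddSubgroup.zmultiples X :=
    (AddSubgroup.eq_of_le_of_card_ge hXle (by rw [hzc, hKcard])).symm
  -- the Galois computation: `e(X, σY)^χ = e(σX, σY) = e(X, Y)^χ`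
  set u : (ZMod m)ˣ := modNCyclotomicCharacter F m σ with hu
  set χ : ℕ := ((u : (ZMod m)ˣ) : ZMod m).val with hχ
  have hσX : σ • X = χ • X := Subtype.ext (by
    rw [AddSubgroup.torsionBy.coe_smul, AddSubmonoidClass.coe_nsmul]; exact hσ)
  -- `w` with `χ w ≡ 1 (mod m)`
  set w : ℕ := (((u⁻¹ : (ZMod m)ˣ) : ZMod m)).val with hw
  have hχw : (χ * w) % m = 1 % m := by
    refine (ZMod.natCast_eq_natCast_iff' (χ * w) 1 m).mp ?_
    rw [Nat.cast_mul, hχ, hw, ZMod.natCast_zmod_val, ZMod.natCast_zmod_val, ← Units.val_mul,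
      mul_inv_cancel, Units.val_one, Nat.cast_one]
  have h1m : 1 % m = 1 := Nat.mod_eq_of_lt (by omega)
  have hcancel : ∀ a b : AlgebraicClosure F, a ^ m = 1 → b ^ m = 1 → a ^ χ = b ^ χ → a = b :=
    fun a b ha hb hab ↦ by
    have h : a ^ (χ * w) = b ^ (χ * w) := by rw [pow_mul, pow_mul, hab]
    rwa [hmod a ha, hmod b hb, hχw, h1m, pow_one, pow_one] at h
  intro y hy
  set Y : geomTorsion W m := ⟨y, hy⟩ with hYdef
  have hkey : e X (σ • Y) = e X Y := by
    have h1 : e (σ • X) (σ • Y) = e X Y ^ χ := by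
      rw [← hgal, modNCyclotomicCharacter_spec F m σ (e X Y) (hpow X Y)]
    rw [hσX, hnsmul_left] at h1
    exact hcancel _ _ (hpow _ _) (hpow _ _) h1
  have hmem : σ • Y - Y ∈ K := by
    rw [hKmem]
    have h : e X (σ • Y - Y) * e X Y = e X Y := by rw [← haddr, sub_add_cancel, hkey]
    exact (mul_eq_right₀ (hne X Y)).mp h
  rw [hK, AddSubgroup.mem_zmultiples_iff] at hmem
  obtain ⟨k, hk⟩ := hmem
  rw [AddSubgroup.mem_zmultiples_iff]
  refine ⟨k, ?_⟩
  have h := congrArg (fun P : geomTorsion W m ↦ (P : geomPoints W)) hk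
  simp only [AddSubgroupClass.coe_sub, AddSubgroup.torsionBy.coe_smul] at h
  exact h

end Summit.BirchSwinnertonDyer.BirchSwinnertonDyer.Theorems.FullDescentOrdinaryNine

end
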